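import Summits.QuantumFields.YangMills.Theorems.UnitScaleTiltHalvingP1FlatCoreDP1TopBonds
import Summits.QuantumFields.YangMills.Theorems.UnitScaleTiltHalvingP1FlatCoreSupplierFramesSU2
import Summits.QuantumFields.YangMills.Theorems.UnitScaleTiltHalvingP1FlatCoreSupplierDoor
import Summits.QuantumFields.YangMills.Theorems.UnitScaleTiltHalvingHSiteTopReads
import Summits.QuantumFields.YangMills.Theorems.UnitScaleTiltHalvingHSiteTorusBlocks
import Summits.QuantumFields.YangMills.Theorems.UnitScaleTiltHalvingP1FlatCoreTopLinearKnit
import HarnessLib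

/-!
# Line H (`BirthV10.stub_halvingStep`, stmt-QuantumFields-19200), the `H42` socket's TOP LEVEL on the ε₁-ROUTE: ★★ THE `htop` ROW OF
# ✓`P1FlatCoreTopH42.H42_top_guarded` AT THE KNIT GAUGE — `‖log U̿^{(k)}((U♯)^{g′})(c♭)‖ ≤ 2·d(M′+ρ′)·ε₁` on every top constraint bond, from the member rows

Cell `ym3-torus` (HUMAN RULING D-0037: YM₃ on T³ is ladder rung R3 — NOT d = 4, NOT a mass gap, NOT the Clay problem), width seat `ym-ust-20520-w3` gen 7
(LEAD-H LOCATE-H42-TOP-w5g5 §2 «ε₁-ROUTE», OWNER ACK 77 (1)).  `--supports stmt-QuantumFields-19200 --as helper`; THEOREMS ONLY (0 `def`, 0 `sorry`); count-neutral;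
nothing here claims `hMember`, `hSupUρ3`, the stub, the crux or the gap.

THE POINT.  The displayed socket `H42` of the per-site composers (✓`HalvingHSiteRowsOfSocketsBase.siteRows_of_sockets_base`, ✓`HalvingHSiteRowsOfSockets.siteRows_of_sockets`)
is consumed (✓`HalvingHSiteSizeRowsOfTopRows.siteSizeRows_of_topRows`) at THE KNIT GAUGE of ✓`HalvingHSiteTopKnit.hknit_of_descent`,
`g′ s := ((u₁ * gaugeExp λ′) (rep s))⁻¹ * toUnits (suIncl (gJ s))`, `rep s := lift x₀ + rel x₀ s`, and its inhabitant-to-be ✓`P1FlatCoreTopH42.H42_top_guarded` needs at the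
top level `j = k := K − n` the row `htop : ∀ c ∈ Λb k, ‖log U̿^{(k)}(Wf)(c♭)‖ ≤ t`, `Wf := (U♯)^{g′}`, `c♭ := ⟨π_k c₋, c.dir⟩`.  LEAD-H located the (E)-route for `t` as
INFEASIBLE and named the ε₁-ROUTE: ✓`P1FlatCoreDP1TopBonds.dbarIterU_chart_eq_holT_contourT_of_top` — under the (top) normalisation `κ′_k = v₀(U̿^{(k)}W₁; y₀, ·)` on a set `T`
the charted field's top double-bar variables on `T`-bonds ARE the axial-contour holonomies `V̄♯(Γ_{y₀,c₋} ∪ c ∪ Γ_{c₊,y₀})` of the `(K−n)`-fold average `V̄ = V` (`U ∈ fibre V`),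
hence within `|c₋ − y₀|₁·ε₁` of `1` when `PlaqSmall ε₁ V` (✓`P1FlatCoreDP1Target.norm_holT_contourT_iter_sub_one_le`).  THIS FILE reads that at the MEMBER: the (top) row of the
member's ∃-body is exactly the normalisation on `T := π_k(□_k^{(k)})` (`□_k^{(k)} = cubeLamS L a M′ ρ′ k k k`), both ends of a top constraint bond lie in `□_k^{(k)}`
(lit ✓`B8CubeMemberZd.ends_inBox_sq_of_bondBox_subset`), the comb lengths are `≤ d(M′+ρ′)` (✓`HalvingHSiteTorusBlocks.l1_rel_coverAt_le`), and the knit gauge is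
`g′ = h′·g = C⁻¹·(C·h′·g)` with `h′ := κf m 0 = e^{−iλ′∘rep}`, `g := (u₁∘rep)⁻¹·(toUnits∘suIncl∘gJ)`, `C := (gs′ k y₀)⁻¹ ν k y₀ ∈ SU(2)`
(✓`HalvingP1FlatCoreSupplierFramesSU2.hCsu_of_near_eta` ⟸ ✓`HalvingHSiteTopReads.topReads_of_datum`): the chart identity is stated for `C·h′·g`, a constant gauge conjugates the
double-bar variables (✓`P1FlatCoreFrameLinTower.dbarIterU_gaugeActT_eq_effGauge` + ✓`P1FlatCoreDP1Target.effGauge_const_mul`), and `‖log (C⁻¹XC)‖ ≤ ‖log X‖` for `C ∈ SU(2)`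
(lit ✓`B7Prop1Explicit.mlog_units_conj`).

WHAT.  §1 `gaugeActT_const_dbarIterU` (constant-gauge covariance of the double-bar tower), `norm_mlog_units_conj_le`, `ends_mem_cubeLamS_top`; §2 ★★ `htop_of_knitGauge` — THE ROW, in the member letters of
✓`siteRows_of_sockets`' ∃-body (`hu₁SU hW hc′ hbudget hc₁ hchartTop hκfs hκf0 hsa htr` + the (top) row) plus `PlaqSmall ε₁ V`, `U ∈ regFibrePr … ε₀ V` and the one window
`2·d(M′+ρ′)·ε₁ ≤ 1`.  HONEST SCOPE: by-name composition over landed theorems; the window `t + C·α₂² < 2dLα₁` of ✓`H42_top_guarded`, its reads row, J3 (d) and the composers'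
reshape are NOT touched here; nothing of Prop. 3, Theorem 4 or [Balaban1985Averaging] is proved in this file.

References: T. Bałaban, CMP **98** (1985) 17–51 [Balaban1985Averaging] ((8) p.19, (86)–(100) pp.30–32, (110) p.34, pp.24–25); CMP **102** (1985) 277–309
[Balaban1985Variational] ((150)–(156) pp.301–302); CMP **99** (1985) 75–102 [Balaban1985RegularSpaces] ((1.42) p.83, (1.131) p.99).
-/

set_option autoImplicit false

noncomputable section

open scoped BigOperators Matrix.Norms.L2Operator
open NormedSpace
open Complex (I)

namespace Summit.QuantumFields.YangMills.Theorems.HalvingHSiteTopH42Datum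

open Literature.MathematicalPhysics.QuantumFieldTheory.Balaban1983to89
open T4Continuum
open Literature.MathematicalPhysics.QuantumFieldTheory.Balaban1983to89.T3ContinuumYM3Torus
open Literature.MathematicalPhysics.QuantumFieldTheory.Balaban1983to89.T3PrintedRegularMinimiser (RegPr regFibrePr mem_regFibrePr_iff)
open Literature.MathematicalPhysics.QuantumFieldTheory.Balaban1983to89.T3UnitLawDensityEML (ℰp)
open MatrixLog (mlog norm_mlog_le_two_mul)
open T3ConstrainedMinimiser (fibre)
open B5Eq118OneStroke (iterBlockOf)
open B7Prop1Explicit renaming Site → LSite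
open B7Prop1Explicit (e l1 U1 mlog_units_conj expUnit val_expUnit val_inv_expUnit)
open B7Prop1Local (InBox)
open B7Eq92Concrete (mgauge)
open B8Eq131Cubes (cube gs sqLo sqHi bLo bHi)
open B8CubeMemberZd (cubeLamS cubeLamB cubeLamS_self inBox_sq_of_mem_cubeLamS ends_inBox_sq_of_bondBox_subset)
open B8Eq131CubesAdmissible (cubeFam cubeFam_false_of_le)
open B8Eq184Proof (gaugeExp cfgExp)
open B10Eq27TorusAxialLog (transl rel pull unitsField toUField suIncl gaugeActT gaugeActT_apply axialT holT contourT)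
open B15Eq112TorusCover (lift cover)
open Node00 (coverAt coverAt_valLift)
open Summit.QuantumFields.YangMills.Theorems.Prop8ChartDoubleBar (dbarIterU vframeU gaugeActT_gaugeActT)
open Summit.QuantumFields.YangMills.Theorems (FlatMinimizerH.le_T3)
open HalvingP1FlatCoreSupplierTowers (exists_nuTower exists_gsTower exists_w_of_su2)
open HalvingP1FlatCoreSupplierFramesSU2 (hCsu_of_near_eta)
open HalvingP1FlatCoreSupplierDoor (exp_neg_I_smul_mem_specialUnitaryGroup mem_U1_of_mem_specialUnitaryGroup)
open HalvingP1FlatCoreSupplierGaugeDescent (hg_of_datum)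
open HalvingHSiteTopReads (topReads_of_datum)
open HalvingHSiteTorusBlocks (rep_mem_cube_top l1_rel_coverAt_le rel_coverAt_eq two_mul_le_sitesPerDir_of_room)
open P1FlatCoreTopLinearKnit (tgt_mk_coverAt)
open P1FlatCoreFrameLinTower (dbarIterU_gaugeActT_eq_effGauge)
open P1FlatCoreDP1Target (effGauge_const_mul norm_holT_contourT_iter_sub_one_le)
open P1FlatCoreDP1TopBonds (dbarIterU_chart_eq_holT_contourT_of_top)

/-! ## §1 Two bookkeeping lemmas: constant gauges and the double-bar tower; the logarithm under `SU(2)` conjugation -/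

section Bookkeeping

variable {P : Params}

/-- **A CONSTANT GAUGE CONJUGATES EVERY DOUBLE-BAR VARIABLE**: `U̿^{(i)}(W^{C}) = C·U̿^{(i)}(W)·C⁻¹` — the effective gauges of the constant gauge `C` are
the constants `C` ((86)∕(97)–(100): a constant conjugates each stair holonomy, hence each frame). [cite: Balaban1985Averaging, (86) p.30, (97)-(100) p.32] -/
theorem gaugeActT_const_dbarIterU (W : GaugeField P 0 (Matrix (Fin 2) (Fin 2) ℂ)ˣ) (C : (Matrix (Fin 2) (Fin 2) ℂ)ˣ) (i : ℕ) :
    dbarIterU i (gaugeActT (fun _ : Site P 0 => C) W) = gaugeActT (fun _ : Site P i => C) (dbarIterU i W) := by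
  -- the effective gauges of the identity gauge are `1`
  have h1 : ∀ (i : ℕ) (y : Site P (i + 1)),
      (fun (i : ℕ) (_ : Site P i) => (1 : (Matrix (Fin 2) (Fin 2) ℂ)ˣ)) (i + 1) y =
        (vframeU (gaugeActT ((fun (i : ℕ) (_ : Site P i) => (1 : (Matrix (Fin 2) (Fin 2) ℂ)ˣ)) i) (dbarIterU i W)) y)⁻¹ *
          (fun (i : ℕ) (_ : Site P i) => (1 : (Matrix (Fin 2) (Fin 2) ℂ)ˣ)) i (emb y) * vframeU (dbarIterU i W) y := by
    intro i y
    have h : gaugeActT ((fun (i : ℕ) (_ : Site P i) => (1 : (Matrix (Fin 2) (Fin 2) ℂ)ˣ)) i) (dbarIterU i W) = dbarIterU i W :=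
      Prop8ChartDoubleBar.gaugeActT_const_one _
    rw [h]
    simp only [mul_one, inv_mul_cancel]
  -- hence those of `C = C·1` are `C·1`
  have hC := effGauge_const_mul W (fun (i : ℕ) (_ : Site P i) => (1 : (Matrix (Fin 2) (Fin 2) ℂ)ˣ)) h1 C
  have h := dbarIterU_gaugeActT_eq_effGauge W (fun _ : Site P 0 => C) (fun (i : ℕ) (_ : Site P i) => C * 1)
    (by funext s; simp only [mul_one]) hC i
  rw [h]
  simp only [mul_one]

/-- **`‖log (C⁻¹·X·C)‖ ≤ ‖log X‖` FOR `C ∈ SU(2)` AND `‖X − 1‖ < 1`** (the logarithmic series commutes with conjugation; `SU(2)` has operator norm one).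
[cite: Balaban1985Averaging, (21)-(23) p.21] -/
theorem norm_mlog_units_conj_le {C X : (Matrix (Fin 2) (Fin 2) ℂ)ˣ} (hC : (C : Matrix (Fin 2) (Fin 2) ℂ) ∈ Matrix.specialUnitaryGroup (Fin 2) ℂ)
    (hX : ‖(X : Matrix (Fin 2) (Fin 2) ℂ) - 1‖ < 1) :
    ‖mlog ((C⁻¹ * X * C : (Matrix (Fin 2) (Fin 2) ℂ)ˣ) : Matrix (Fin 2) (Fin 2) ℂ)‖ ≤ ‖mlog (X : Matrix (Fin 2) (Fin 2) ℂ)‖ := by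
  have hCU1 : C ∈ U1 (Matrix (Fin 2) (Fin 2) ℂ) := mem_U1_of_mem_specialUnitaryGroup hC
  have hCiU1 : C⁻¹ ∈ U1 (Matrix (Fin 2) (Fin 2) ℂ) := by
    refine ⟨hCU1.2, ?_⟩
    rw [inv_inv]; exact hCU1.1
  have hval : ((C⁻¹ * X * C : (Matrix (Fin 2) (Fin 2) ℂ)ˣ) : Matrix (Fin 2) (Fin 2) ℂ) =
      ((C⁻¹ : (Matrix (Fin 2) (Fin 2) ℂ)ˣ) : Matrix (Fin 2) (Fin 2) ℂ) * (X : Matrix (Fin 2) (Fin 2) ℂ) * (((C⁻¹)⁻¹ : (Matrix (Fin 2) (Fin 2) ℂ)ˣ) : Matrix (Fin 2) (Fin 2) ℂ) := by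
    rw [inv_inv, Units.val_mul, Units.val_mul]
  rw [hval, mlog_units_conj hCiU1 hX]
  calc ‖((C⁻¹ : (Matrix (Fin 2) (Fin 2) ℂ)ˣ) : Matrix (Fin 2) (Fin 2) ℂ) * mlog (X : Matrix (Fin 2) (Fin 2) ℂ) * (((C⁻¹)⁻¹ : (Matrix (Fin 2) (Fin 2) ℂ)ˣ) : Matrix (Fin 2) (Fin 2) ℂ)‖
      ≤ ‖((C⁻¹ : (Matrix (Fin 2) (Fin 2) ℂ)ˣ) : Matrix (Fin 2) (Fin 2) ℂ)‖ * ‖mlog (X : Matrix (Fin 2) (Fin 2) ℂ)‖ * ‖(((C⁻¹)⁻¹ : (Matrix (Fin 2) (Fin 2) ℂ)ˣ) : Matrix (Fin 2) (Fin 2) ℂ)‖ := by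
        refine (norm_mul_le _ _).trans (mul_le_mul_of_nonneg_right (norm_mul_le _ _) (norm_nonneg _))
    _ ≤ 1 * ‖mlog (X : Matrix (Fin 2) (Fin 2) ℂ)‖ * 1 := by
        gcongr
        · exact hCiU1.1
        · exact hCiU1.2
    _ = ‖mlog (X : Matrix (Fin 2) (Fin 2) ℂ)‖ := by ring

/-- **BOTH ENDS OF A TOP CONSTRAINT BOND LIE IN `□_k^{(k)}`**: for `c ∈ cubeLamB L a M′ ρ′ k k k` (its fine box lies in `□_k`, lit `hbox_cubeLamB`), `c₋` and `c₊ = c₋ + e`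
belong to `cubeLamS L a M′ ρ′ k k k = □_k^{(k)}` (lit ✓`B8CubeMemberZd.ends_inBox_sq_of_bondBox_subset`; at the top level there are no crossing bonds).
[cite: Balaban1985RegularSpaces, (1.31) p.82, (1.131) p.99] -/
theorem ends_mem_cubeLamS_top {d L : ℕ} (hL : 1 ≤ L) (a : LSite d) (M' ρ' k : ℕ) {c : LSite d × Fin d} (hc : c ∈ cubeLamB L a M' ρ' k k k) :
    c.1 ∈ cubeLamS L a M' ρ' k k k ∧ c.1 + e c.2 ∈ cubeLamS L a M' ρ' k k k := by
  have hkk : cubeFam false L a M' ρ' k k = cube L a M' ρ' k k := cubeFam_false_of_le _ _ _ _ le_rfl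
  have hends := ends_inBox_sq_of_bondBox_subset hL a M' ρ' k k (z := c.1) (μ := c.2) (fun x hx => hkk ▸ hc.1 x hx)
  have he0 : ∀ i, (0 : ℤ) ≤ e c.2 i := fun i => by
    rw [B7Prop1Explicit.e_apply]; split_ifs <;> norm_num
  rw [cubeLamS_self]
  refine ⟨fun i => ⟨hends.1 i, ?_⟩, fun i => ⟨?_, hends.2 i⟩⟩
  · have h := hends.2 i
    simp only [Pi.add_apply] at h
    linarith [he0 i]
  · have h := hends.1 i
    simp only [Pi.add_apply]
    linarith [he0 i]

end Bookkeeping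


/-! ## §2 ★★ The `htop` row at the knit gauge, from the member rows -/

section Member

variable (F : T3Family) {n K : ℕ}

/-- ★★ **THE `htop` ROW OF ✓`P1FlatCoreTopH42.H42_top_guarded` AT THE KNIT GAUGE, FROM THE MEMBER ROWS (ε₁-ROUTE).**  At one site `x₀` of the family's `K`-th torus, top
level `k := K − n`, window corner `a` with `a ≤ Bᵏx₀ ≤ a + M′ − 1` (`ha`) and the room `hroomW`; for `U ∈ regFibrePr … ε₀ V` with `PlaqSmall ε₁ V`, Theorem 4's datum
`(u₁, W, A)` in the member's letters (`u₁` special unitary, `W^{u₁} = pull (U^{gJ})♯ 0`, the chart with size `c₁` on the top cube `□_k`, `e^{c₁} − 1 ≤ L^{−k}c′`,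
frame budget `8·3800·((d+2)L)²·c′ ≤ 1`), F3's effective-gauge tower `κf` over `W₁ := (U♯)^{g}`, `g := (u₁∘rep)⁻¹·(toUnits∘suIncl∘gJ)` (`hκfs`, `hκf0`), the top step's
Hermitian traceless `λ′` and its (top) row `κf((−i)λ′∘rep) k (π_k yc) = v₀(U̿^{(k)}W₁; Bᵏx₀, π_k yc)` on `□_k^{(k)} = cubeLamS L a M′ ρ′ k k k`, and the window `2·d(M′+ρ′)·ε₁ ≤ 1`:
for every top constraint bond `c ∈ cubeLamB L a M′ ρ′ k k k`,
`‖log U̿^{(k)}((U♯)^{g′})(⟨π_k c₋, c.dir⟩)‖ ≤ 2·d(M′+ρ′)·ε₁`, `g′ s := ((u₁ * gaugeExp λ′)(rep s))⁻¹ * toUnits (suIncl (gJ s))` (✓`HalvingHSiteTopKnit.hknit_of_descent`'s gauge).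
Route: module docstring. [cite: Balaban1985Averaging, (8) p.19, (86)-(100) pp.30-32, (110) p.34, pp.24-25; Balaban1985Variational, (150)-(156) pp.301-302; Balaban1985RegularSpaces, (1.42) p.83, (1.131) p.99] -/
theorem htop_of_knitGauge (hnK : n < K) (x₀ : Site (F.P K) 0) {a : LSite (F.P K).d} {M' ρ' : ℕ} (hρ'1 : 1 ≤ ρ')
    (ha : ∀ ν, a ν ≤ ((iterBlockOf (K - n) x₀ ν).val : ℤ) ∧ ((iterBlockOf (K - n) x₀ ν).val : ℤ) ≤ a ν + M' - 1)
    (hroomW : 2 * ((F.P K).L ^ (K - n) * (M' + 1) + ρ' * gs (F.P K).L (K - n)) ≤ (F.P K).sitesPerDir 0)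
    {ε₀ ε₁ : ℝ} (hε₀ : 0 < ε₀) (hε : 10 ^ 7 * (F.L : ℝ) ^ 3 * ε₀ ≤ 1) (hε₁ : 0 ≤ ε₁)
    (V : GaugeField (F.P n) 0 (Matrix.specialUnitaryGroup (Fin 2) ℂ)) (hV : PlaqSmall ε₁ V)
    (U : GaugeField (F.P K) 0 (Matrix.specialUnitaryGroup (Fin 2) ℂ)) (hU : U ∈ regFibrePr F n K hnK.le ε₀ V)
    (gJ : GaugeTransf (F.P K) 0 (Matrix.specialUnitaryGroup (Fin 2) ℂ))
    -- Theorem 4's datum in the member's letters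
    {u₁ : LSite (F.P K).d → (Matrix (Fin 2) (Fin 2) ℂ)ˣ} {W : LSite (F.P K).d → Fin (F.P K).d → (Matrix (Fin 2) (Fin 2) ℂ)ˣ}
    {A : LSite (F.P K).d → Fin (F.P K).d → Matrix (Fin 2) (Fin 2) ℂ}
    (hu₁SU : ∀ z, ((u₁ z : (Matrix (Fin 2) (Fin 2) ℂ)ˣ) : Matrix (Fin 2) (Fin 2) ℂ) ∈ Matrix.specialUnitaryGroup (Fin 2) ℂ)
    (hW : mgauge (1 : LSite (F.P K).d → Fin (F.P K).d → (Matrix (Fin 2) (Fin 2) ℂ)ˣ) u₁ W = pull (unitsField (toUField (GaugeField.gaugeAct gJ U))) 0)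
    {c₁ c' : ℝ} (hc' : 0 ≤ c') (hbudget : 8 * 3800 * ((((F.P K).d + 2) * (F.P K).L : ℕ) : ℝ) ^ 2 * c' ≤ 1)
    (hc₁ : Real.exp c₁ - 1 ≤ ((F.L : ℝ)⁻¹) ^ (K - n) * c')
    (hchartTop : ∀ z ∈ cube (F.P K).L a M' ρ' (K - n) (K - n), ∀ ν : Fin (F.P K).d,
      W z ν = cfgExp (((F.L : ℝ)⁻¹) ^ (K - n)) A z ν ∧ ((F.L : ℝ)⁻¹) ^ (K - n) * ‖A z ν‖ ≤ c₁)
    -- F3's effective-gauge tower over the pre-gauged field (VERBATIM rows of the member's ∃-body)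
    {κf : (Site (F.P K) 0 → Matrix (Fin 2) (Fin 2) ℂ) → (i : ℕ) → GaugeTransf (F.P K) i (Matrix (Fin 2) (Fin 2) ℂ)ˣ}
    (hκfs : ∀ (m : Site (F.P K) 0 → Matrix (Fin 2) (Fin 2) ℂ) (i : ℕ) (y : Site (F.P K) (i + 1)),
      κf m (i + 1) y = (vframeU (gaugeActT (κf m i) (dbarIterU i (gaugeActT
        (fun s => (u₁ (lift (F.P K) x₀ + rel x₀ s))⁻¹ * Unitary.toUnits (suIncl (gJ s)) : GaugeTransf (F.P K) 0 (Matrix (Fin 2) (Fin 2) ℂ)ˣ)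
        (unitsField (toUField U))))) y)⁻¹ * κf m i (emb y) *
        vframeU (dbarIterU i (gaugeActT
          (fun s => (u₁ (lift (F.P K) x₀ + rel x₀ s))⁻¹ * Unitary.toUnits (suIncl (gJ s)) : GaugeTransf (F.P K) 0 (Matrix (Fin 2) (Fin 2) ℂ)ˣ)
          (unitsField (toUField U)))) y)
    (hκf0 : ∀ (m : Site (F.P K) 0 → Matrix (Fin 2) (Fin 2) ℂ) (x : Site (F.P K) 0), ((κf m 0 x : (Matrix (Fin 2) (Fin 2) ℂ)ˣ) : Matrix (Fin 2) (Fin 2) ℂ) = exp (m x))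
    -- the top step's Landau function and its (top) row (VERBATIM)
    {lam : LSite (F.P K).d → Matrix (Fin 2) (Fin 2) ℂ} (hsa : ∀ x, IsSelfAdjoint (lam x)) (htr : ∀ x, (lam x).trace = 0)
    (htopRow : ∀ yc ∈ cubeLamS (F.P K).L a M' ρ' (K - n) (K - n) (K - n),
      κf (((-I) • lam) ∘ fun s : Site (F.P K) 0 => lift (F.P K) x₀ + rel x₀ s) (K - n) (coverAt (F.P K) (K - n) yc) =
        axialT (dbarIterU (K - n) (gaugeActT
          (fun s => (u₁ (lift (F.P K) x₀ + rel x₀ s))⁻¹ * Unitary.toUnits (suIncl (gJ s)) : GaugeTransf (F.P K) 0 (Matrix (Fin 2) (Fin 2) ℂ)ˣ)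
          (unitsField (toUField U)))) (iterBlockOf (K - n) x₀) (coverAt (F.P K) (K - n) yc))
    -- the one window
    (hε₁l : 2 * ((((F.P K).d * (M' + ρ') : ℕ) : ℝ) * ε₁) ≤ 1) :
    ∀ c ∈ cubeLamB (F.P K).L a M' ρ' (K - n) (K - n) (K - n),
      ‖mlog ((dbarIterU (K - n) (gaugeActT
          (fun s => ((u₁ * gaugeExp lam) (lift (F.P K) x₀ + rel x₀ s))⁻¹ * Unitary.toUnits (suIncl (gJ s)) :
            GaugeTransf (F.P K) 0 (Matrix (Fin 2) (Fin 2) ℂ)ˣ) (unitsField (toUField U)))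
          ⟨coverAt (F.P K) (K - n) c.1, c.2⟩ : (Matrix (Fin 2) (Fin 2) ℂ)ˣ) : Matrix (Fin 2) (Fin 2) ℂ)‖ ≤
        2 * ((((F.P K).d * (M' + ρ') : ℕ) : ℝ) * ε₁) := by
  classical
  intro c hc
  have hk : K - n ≤ (F.P K).m + (F.P K).K := FlatMinimizerH.le_T3 F n K
  have hL1 : 1 ≤ (F.P K).L := (F.P K).L_pos
  have hL0 : (0 : ℝ) < (F.L : ℝ) := by have := F.hL.2; exact_mod_cast (by omega : 0 < F.L)
  have hη0 : (0 : ℝ) ≤ ((F.L : ℝ)⁻¹) ^ (K - n) := pow_nonneg (inv_nonneg.2 hL0.le) _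
  obtain ⟨hUV, hUreg⟩ := (mem_regFibrePr_iff F).1 hU
  -- letters
  set y₀ : Site (F.P K) (K - n) := iterBlockOf (K - n) x₀ with hy₀
  set g : GaugeTransf (F.P K) 0 (Matrix (Fin 2) (Fin 2) ℂ)ˣ :=
    fun s => (u₁ (lift (F.P K) x₀ + rel x₀ s))⁻¹ * Unitary.toUnits (suIncl (gJ s)) with hgdef
  set W₁ : GaugeField (F.P K) 0 (Matrix (Fin 2) (Fin 2) ℂ)ˣ := gaugeActT g (unitsField (toUField U)) with hW₁
  set m : Site (F.P K) 0 → Matrix (Fin 2) (Fin 2) ℂ := ((-I) • lam) ∘ fun s : Site (F.P K) 0 => lift (F.P K) x₀ + rel x₀ s with hm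
  -- the two towers and the frame constant
  obtain ⟨ν, hν0, hνs⟩ := exists_nuTower (F := F) (K := K) W₁
  obtain ⟨gs', hg0, hgs⟩ := exists_gsTower (F := F) (K := K) g
  set C : (Matrix (Fin 2) (Fin 2) ℂ)ˣ := (gs' (K - n) y₀)⁻¹ * ν (K - n) y₀ with hC
  have hgSU : ∀ s, ((g s : (Matrix (Fin 2) (Fin 2) ℂ)ˣ) : Matrix (Fin 2) (Fin 2) ℂ) ∈ Matrix.specialUnitaryGroup (Fin 2) ℂ :=
    hg_of_datum x₀ gJ u₁ hu₁SU
  -- the labels of `y₀` lie in `□_k^{(k)}`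
  have hycmem : (fun μ => ((y₀ μ).val : ℤ)) ∈ cubeLamS (F.P K).L a M' ρ' (K - n) (K - n) (K - n) := by
    rw [cubeLamS_self]
    intro i
    obtain ⟨h1, h2⟩ := ha i
    have hρ0 : (0 : ℤ) ≤ (ρ' : ℤ) := by positivity
    simp only [sqLo, sqHi, bLo, bHi, Nat.sub_self, pow_zero, one_mul, B8Eq131Cubes.gs_zero, mul_one]
    constructor <;> linarith
  -- near-flatness of `W₁` on the top block of `x₀` (✓`topReads_of_datum`), hence `C ∈ SU(2)`
  have hW1near : ∀ b : PBond (F.P K) 0, iterBlockOf (K - n) b.src = iterBlockOf (K - n) x₀ → iterBlockOf (K - n) b.tgt = iterBlockOf (K - n) x₀ →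
      ‖((W₁ b : (Matrix (Fin 2) (Fin 2) ℂ)ˣ) : Matrix (Fin 2) (Fin 2) ℂ) - 1‖ ≤ ((F.L : ℝ)⁻¹) ^ (K - n) * c' := by
    intro b hbs _
    have hrepb : lift (F.P K) x₀ + rel x₀ b.src ∈ cube (F.P K).L a M' ρ' (K - n) (K - n) :=
      rep_mem_cube_top hk x₀ ha hroomW hycmem (by rw [hbs, hy₀, coverAt_valLift])
    exact (topReads_of_datum hnK x₀ hρ'1 ha hroomW U gJ hu₁SU hW hη0 hchartTop b hrepb).1.trans hc₁
  have hCsu : ((C : (Matrix (Fin 2) (Fin 2) ℂ)ˣ) : Matrix (Fin 2) (Fin 2) ℂ) ∈ Matrix.specialUnitaryGroup (Fin 2) ℂ :=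
    hCsu_of_near_eta x₀ U g hgSU ν hν0 hνs gs' hg0 hgs hc' hbudget hW1near
  -- `h′ := κf m 0 = e^{−iλ′∘rep}`; the composite `G := C·h′·g` is special unitary
  have hκ0 : ∀ s, κf m 0 s = (gaugeExp lam (lift (F.P K) x₀ + rel x₀ s))⁻¹ := by
    intro s
    apply Units.ext
    rw [hκf0, gaugeExp, val_inv_expUnit, val_expUnit, hm, Function.comp_apply, Pi.smul_apply, neg_smul]
  set G : Site (F.P K) 0 → (Matrix (Fin 2) (Fin 2) ℂ)ˣ := fun s => C * κf m 0 s * g s with hG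
  have hGsu : ∀ s, ((G s : (Matrix (Fin 2) (Fin 2) ℂ)ˣ) : Matrix (Fin 2) (Fin 2) ℂ) ∈ Matrix.specialUnitaryGroup (Fin 2) ℂ := by
    intro s
    rw [hG]
    dsimp only
    rw [Units.val_mul, Units.val_mul]
    refine Submonoid.mul_mem _ (Submonoid.mul_mem _ hCsu ?_) (hgSU s)
    rw [hκf0, hm, Function.comp_apply, Pi.smul_apply]
    exact exp_neg_I_smul_mem_specialUnitaryGroup (hsa _) (htr _)
  obtain ⟨w, -, hws⟩ := exists_w_of_su2 x₀ G hGsu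
  -- the unitary-group chart gauge `u` with `u⁻¹ = C·h′·g`
  have hug : ∀ s : Site (F.P K) 0,
      (Unitary.toUnits ((fun s => suIncl (w (lift (F.P K) x₀ + rel x₀ s)) : GaugeTransf (F.P K) 0 (Matrix.unitaryGroup (Fin 2) ℂ)) s))⁻¹ =
        ((gs' (K - n) (iterBlockOf (K - n) x₀))⁻¹ * ν (K - n) (iterBlockOf (K - n) x₀)) * κf m 0 s * g s := fun s => hws s
  -- the (top) set and the normalisation on it
  set T : Set (Site (F.P K) (K - n)) :=
    {y | ∃ yc ∈ cubeLamS (F.P K).L a M' ρ' (K - n) (K - n) (K - n), y = coverAt (F.P K) (K - n) yc} with hT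
  have hlam : ∀ y : Site (F.P K) (K - n), y ∈ T → κf m (K - n) y = axialT (dbarIterU (K - n) W₁) (iterBlockOf (K - n) x₀) y := by
    rintro y ⟨yc, hyc, rfl⟩
    exact htopRow yc hyc
  -- the top constraint bond: both ends in `□_k^{(k)}`
  obtain ⟨hc1mem, hc2mem⟩ := ends_mem_cubeLamS_top hL1 a M' ρ' (K - n) hc
  have hsq1 : InBox (sqLo (F.P K).L a ρ' (K - n) (K - n)) (sqHi (F.P K).L a M' ρ' (K - n) (K - n)) c.1 := by
    have h := hc1mem; rwa [cubeLamS_self] at h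
  have he0 : ∀ i, (0 : ℤ) ≤ e c.2 i := fun i => by
    rw [B7Prop1Explicit.e_apply]; split_ifs <;> norm_num
  have he1 : ∀ i, e c.2 i ≤ (1 : ℤ) := fun i => by
    rw [B7Prop1Explicit.e_apply]; split_ifs <;> norm_num
  set cb : PBond (F.P K) (K - n) := ⟨coverAt (F.P K) (K - n) c.1, c.2⟩ with hcb
  have hsrc : cb.src ∈ T := ⟨c.1, hc1mem, rfl⟩
  have htgt : cb.tgt ∈ T := ⟨c.1 + e c.2, hc2mem, tgt_mk_coverAt _ _ _⟩
  -- relative position, no wrap, comb length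
  have hrel : rel (iterBlockOf (K - n) x₀) cb.src = c.1 - fun μ => ((iterBlockOf (K - n) x₀ μ).val : ℤ) :=
    rel_coverAt_eq hk x₀ ha hroomW hc1mem
  have hN := two_mul_le_sitesPerDir_of_room hk hroomW
  have hl1 : l1 (rel (iterBlockOf (K - n) x₀) cb.src) ≤ (F.P K).d * (M' + ρ') := l1_rel_coverAt_le hk x₀ ha hroomW c.1 hc1mem
  have hco : ∀ i, -(((M' : ℤ) - 1) + ρ') ≤ rel (iterBlockOf (K - n) x₀) cb.src i ∧ rel (iterBlockOf (K - n) x₀) cb.src i ≤ ((M' : ℤ) - 1) + ρ' := by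
    intro i
    rw [hrel]
    obtain ⟨h1, h2⟩ := hsq1 i
    obtain ⟨h3, h4⟩ := ha i
    simp only [sqLo, sqHi, bLo, bHi, Nat.sub_self, pow_zero, one_mul, B8Eq131Cubes.gs_zero, mul_one] at h1 h2
    simp only [Pi.sub_apply]
    constructor <;> linarith
  have hMρ : (0 : ℤ) ≤ (M' : ℤ) + ρ' := by positivity
  have hlohi : ∀ i : Fin (F.P K).d, (fun _ : Fin (F.P K).d => -((M' : ℤ) + ρ')) i ≤ (fun _ : Fin (F.P K).d => (M' : ℤ) + ρ') i := fun i => by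
    dsimp only; linarith
  have hbox0 : InBox (fun _ : Fin (F.P K).d => -((M' : ℤ) + ρ')) (fun _ : Fin (F.P K).d => (M' : ℤ) + ρ') 0 := fun i => by
    simp only [Pi.zero_apply]; constructor <;> linarith
  have hcbx : InBox (fun _ : Fin (F.P K).d => -((M' : ℤ) + ρ')) (fun _ : Fin (F.P K).d => (M' : ℤ) + ρ') (rel (iterBlockOf (K - n) x₀) cb.src) :=
    fun i => ⟨by linarith [(hco i).1], by linarith [(hco i).2]⟩
  have hce : InBox (fun _ : Fin (F.P K).d => -((M' : ℤ) + ρ')) (fun _ : Fin (F.P K).d => (M' : ℤ) + ρ') (rel (iterBlockOf (K - n) x₀) cb.src + e cb.dir) :=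
    fun i => ⟨by simp only [Pi.add_apply]; linarith [(hco i).1, he0 i], by simp only [Pi.add_apply]; linarith [(hco i).2, he1 i]⟩
  have hcN : (rel (iterBlockOf (K - n) x₀) cb.src cb.dir + 1) * 2 ≤ ((F.P K).sitesPerDir (K - n) : ℤ) := by
    have hNz : (2 : ℤ) * ((M' : ℤ) + 1 + ρ') ≤ ((F.P K).sitesPerDir (K - n) : ℤ) := by exact_mod_cast hN
    linarith [(hco cb.dir).2]
  -- the chart identity at `u⁻¹ = C·h′·g` and the contour bound
  have hid := dbarIterU_chart_eq_holT_contourT_of_top F n K x₀ U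
    (fun s => suIncl (w (lift (F.P K) x₀ + rel x₀ s))) g (κf m 0) (κf m) rfl (hκfs m) ν hν0 hνs gs' hg0 hgs hε₀ hε hUreg.1 hug T hlam cb hsrc htgt hcN
  have hnear := norm_holT_contourT_iter_sub_one_le F n K hnK.le hε₁ V U hUV hV (iterBlockOf (K - n) x₀) hlohi hbox0 cb hcbx hce
  have hl1ε : (l1 (rel (iterBlockOf (K - n) x₀) cb.src) : ℝ) * ε₁ ≤ (((F.P K).d * (M' + ρ') : ℕ) : ℝ) * ε₁ :=
    mul_le_mul_of_nonneg_right (by exact_mod_cast hl1) hε₁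
  have hhalf : (l1 (rel (iterBlockOf (K - n) x₀) cb.src) : ℝ) * ε₁ ≤ 1 / 2 := by linarith
  -- the knit gauge is `C⁻¹·(C·h′·g)`
  have hgauge : (fun s => ((u₁ * gaugeExp lam) (lift (F.P K) x₀ + rel x₀ s))⁻¹ * Unitary.toUnits (suIncl (gJ s)) :
        GaugeTransf (F.P K) 0 (Matrix (Fin 2) (Fin 2) ℂ)ˣ) =
      fun s => C⁻¹ * (Unitary.toUnits ((fun s => suIncl (w (lift (F.P K) x₀ + rel x₀ s)) : GaugeTransf (F.P K) 0 (Matrix.unitaryGroup (Fin 2) ℂ)) s))⁻¹ := by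
    funext s
    rw [hug s, hκ0 s, ← hC, Pi.mul_apply, mul_inv_rev, hgdef]
    dsimp only
    group
  have hsplit : gaugeActT (fun s => ((u₁ * gaugeExp lam) (lift (F.P K) x₀ + rel x₀ s))⁻¹ * Unitary.toUnits (suIncl (gJ s)) :
        GaugeTransf (F.P K) 0 (Matrix (Fin 2) (Fin 2) ℂ)ˣ) (unitsField (toUField U)) =
      gaugeActT (fun _ : Site (F.P K) 0 => C⁻¹)
        (gaugeActT (fun s => (Unitary.toUnits ((fun s => suIncl (w (lift (F.P K) x₀ + rel x₀ s)) : GaugeTransf (F.P K) 0 (Matrix.unitaryGroup (Fin 2) ℂ)) s))⁻¹)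
          (unitsField (toUField U))) := by
    rw [gaugeActT_gaugeActT, hgauge]
  rw [hsplit, gaugeActT_const_dbarIterU, gaugeActT_apply, hid, inv_inv]
  have hX1 : ‖((holT (unitsField (toUField (Averaging.iter (fun i => BlockAveraging.blockAvg (P := F.P K) (j := i) ℰp) (K - n) U)))
      (iterBlockOf (K - n) x₀) (contourT (iterBlockOf (K - n) x₀) cb) : (Matrix (Fin 2) (Fin 2) ℂ)ˣ) : Matrix (Fin 2) (Fin 2) ℂ) - 1‖ < 1 :=
    (hnear.trans hhalf).trans_lt (by norm_num)
  calc _ ≤ ‖mlog ((holT (unitsField (toUField (Averaging.iter (fun i => BlockAveraging.blockAvg (P := F.P K) (j := i) ℰp) (K - n) U)))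
          (iterBlockOf (K - n) x₀) (contourT (iterBlockOf (K - n) x₀) cb) : (Matrix (Fin 2) (Fin 2) ℂ)ˣ) : Matrix (Fin 2) (Fin 2) ℂ)‖ :=
        norm_mlog_units_conj_le hCsu hX1
    _ ≤ 2 * ‖((holT (unitsField (toUField (Averaging.iter (fun i => BlockAveraging.blockAvg (P := F.P K) (j := i) ℰp) (K - n) U)))
          (iterBlockOf (K - n) x₀) (contourT (iterBlockOf (K - n) x₀) cb) : (Matrix (Fin 2) (Fin 2) ℂ)ˣ) : Matrix (Fin 2) (Fin 2) ℂ) - 1‖ :=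
        norm_mlog_le_two_mul (hnear.trans hhalf)
    _ ≤ 2 * ((l1 (rel (iterBlockOf (K - n) x₀) cb.src) : ℝ) * ε₁) := by linarith
    _ ≤ 2 * ((((F.P K).d * (M' + ρ') : ℕ) : ℝ) * ε₁) := by linarith

end Member

end Summit.QuantumFields.YangMills.Theorems.HalvingHSiteTopH42Datum

end
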